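import Summits.CriticalPhenomena.PercolationContinuityZ3.Theorems.PercNearOneGluingNoHeavyPcintVdBEProcess
import HarnessLib

/-!
# PCINT lane, king route, K1: the comparison inequality on a finite box, MODULO the local domination (step (3))

Cell `prim-pcint`, seat `prim-pcint-1` (gen 9); memo `run/shared/lean/prim/pcint/KING-ROUTE.md` §K1.

This file pins the interfaces of the landed K1 pieces by composing them: for a finite set `Λ ⊆ ℤ²` with root `o`,
a target set `B ⊆ Λ`, a probability weight `μ` on the pair states `Λ → Bool × Bool` and `q ∈ [0,1]`, IF van den
Berg–Ermakov's oracle `VdBEProcess.outVdBE` is step-wise dominating (`AdaptDom.Dominating q rule μ outVdBE` — K1 step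
(3), to be proved from `VdBELocal.checkCD_of_mem_geoms` / `checkRoot_of_mem` / the origin table by the Markov
decomposition), THEN

  `E_{π_q}[𝟙{o ⟷ B by open sites of Λ}] ≤ μ{w | an open ∗-path of cfg w joins the pair of o to the pair of a site of B}`

(`KingRoute.sum_wt_reach_le_sum_mu_starPath`): `AdaptDom.expect_le_of_dominating` with the rule `ClusterExpl.rule`
(`rule_unrevealed`, `reach_determined`, `reachIndicator_mono`) and `VdBEProcess.exists_pathIn_star_of_reach`.
The two remaining bridges of the assembly (K1 step (6)) identify the left side with
`P_q(exitEvent (zdGraph 2) Λ o)` and bound the right side by a `P_p`-probability of `∗`-connections in `ℤ²∗`.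
-/

noncomputable section

namespace Summit.CriticalPhenomena.PercolationContinuityZ3.Theorems.Pcint

namespace KingRoute

open Finset AdaptDom ClusterExpl KingPairs VdBEProcess Literature.Probability.Percolation Literature.Probability.LatticeModels

variable {Λ : Finset (Site 2)} (enc : ↥Λ → ℕ) (o : ↥Λ) (B : Finset ↥Λ)

open Classical in
/-- **The comparison inequality on a box, modulo step-wise domination**: if `outVdBE` dominates `π_q` step-wise under
the weight `μ` (total mass `1`), then the `π_q`-probability that `o` is joined to `B` by open sites of `Λ` is at most
the `μ`-weight of the pair-state assignments in which an open `∗`-path of `cfg w` joins a site of the pair of `o` to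
a site of the pair of some `v ∈ B`. -/
theorem sum_wt_reach_le_sum_mu_starPath {q : ℝ} (hq0 : 0 ≤ q) (hq1 : q ≤ 1) (μ : (↥Λ → Bool × Bool) → ℝ)
    (hμ0 : ∀ w, 0 ≤ μ w) (hμ : ∑ w, μ w = 1)
    (hdom : Dominating q (rule (boxGraph Λ) enc o) μ (outVdBE Λ enc)) :
    ∑ ω : ↥Λ → Bool, wt q ω * reachIndicator (boxGraph Λ) o B ω ≤
      ∑ w : ↥Λ → Bool × Bool, μ w *
        (if ∃ v ∈ B, ∃ i j : Bool, pairSite o.1 i ∈ cfg Λ w ∧ pairSite v.1 j ∈ cfg Λ w ∧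
            PathIn zdStarGraph (cfg Λ w) (pairSite o.1 i) (pairSite v.1 j) then (1 : ℝ) else 0) := by
  set N := Fintype.card ↥Λ + 1 with hN
  let ω₀ : ↥Λ → Bool := fun _ => false
  -- adaptive domination
  have h1 := expect_le_of_dominating hq0 hq1 (reachIndicator_mono (boxGraph Λ) o B) (rule (boxGraph Λ) enc o)
    (rule_unrevealed (boxGraph Λ) enc o) μ hμ (outVdBE Λ enc) hdom N ω₀
    (fun w ω => reach_determined (boxGraph Λ) enc o B (outVdBE Λ enc w) ω ω₀)
  refine h1.trans (Finset.sum_le_sum fun w _ => mul_le_mul_of_nonneg_left ?_ (hμ0 w))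
  -- payoff `1` forces a `∗`-path
  unfold reachIndicator
  split_ifs with hreach hpath
  · exact le_rfl
  · exfalso
    apply hpath
    have hval : reachIndicator (boxGraph Λ) o B (merge (run (rule (boxGraph Λ) enc o) (outVdBE Λ enc w) N) ω₀) = 1 := by
      unfold reachIndicator; rw [if_pos hreach]
    obtain ⟨v, hvB, i, j, hi, hj, hp⟩ := exists_pathIn_star_of_reach (enc := enc) (o := o) w B ω₀ hval
    exact ⟨v, hvB, i, j, hi, hj, hp⟩
  · norm_num
  · norm_num

end KingRoute

end Summit.CriticalPhenomena.PercolationContinuityZ3.Theorems.Pcint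

end
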